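import Summits.HodgeConjecture.HodgeConjecture.Theorems.Ring2WeilCoverageRamifiedTypes
import Summits.HodgeConjecture.HodgeConjecture.Theorems.Ring2WeilCoverageRamifiedPrimePowers
import Summits.HodgeConjecture.HodgeConjecture.Theorems.Ring2WeilCoverageCyclotomicSignaturesG10
import Summits.HodgeConjecture.HodgeConjecture.Theorems.Ring2WeilCoverageCyclotomicUnconditionalSqrtNegEleven
import HarnessLib

/-!
# Weil-type family coverage — RAMIFIED TYPES AT THE `g = 10` NO LEVELS `33` AND `44`: every `ℚ(√−11)`-balanced CM type of
# `ℚ(ζ₃₃)` resp. `ℚ(ζ₄₄)` carries a polarisation of type `𝔮₁₁` (`𝔮₁₁¹⁰ = (11)`, degree `11`, elementary divisors `(1⁹, 11)`);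
# the `ℚ(√−3)`- resp. `ℚ(i)`-balanced (YES-row) types do not; dichotomies for all `2¹⁰` CM types

research route conditional on HC_CM; not a corollary; Q11.4-sentence-2 already refuted in dim ≥ 3.

Ring 2, WEIL-TYPE FAMILY-COVERAGE CENSUS (`HOME/WEIL-FAMILY-COVERAGE.md` `## b01`, blocks b01.34 (the NO rows `(33, √−11)`,
`(44, √−11)`: no `ι`-compatible principal polarisation on `ℂ^Φ/Φ(ℤ[ζ_M])`; THEOREM L (i) by `√33`, `√11`), b01.36 (THEOREM L (ii)
at 33/44); owner ring2-b01), part 50 of the `Ring2WeilCoverage*` series (parts 48 / 48c):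

* level `33`, `π = ζ³¹(1 − ζ³)(1 − ζ)` (`ζ³` a primitive 11th root: `(π) = (1 − ζ³) = 𝔭₁₁`, `(π)¹⁰ = (11)`, `N(𝔬𝔣₀) = 121`):
  `twistSet_thirtyThree` (`X_π = {2, 5, 8, 14, 17, 20, 23, 26, 29, 32}`, `|A_π|/2 = 7`), `map_type_pow_thirtyThree`,
  **`exists_type_thirtyThree_sqrt_neg_eleven`** / **`exists_ramifiedType_thirtyThree_sqrt_neg_eleven`**,
  `not_exists_type_thirtyThree_sqrt_neg_three`, **`exists_principal_xor_type_thirtyThree`**;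
* level `44`, `π = ζ⁴¹(1 − ζ⁴)(1 − ζ²)` (`ζ⁴` a primitive 11th root: `(π) = 𝔭₁₁`, `(π)¹⁰ = (11)`): `twistSet_fortyFour`
  (`X_π = {3, 7, 15, 19, 23, 27, 31, 35, 39, 43}`, `|A_π|/2 = 5`), `map_type_pow_fortyFour`,
  **`exists_type_fortyFour_sqrt_neg_eleven`** / **`exists_ramifiedType_fortyFour_sqrt_neg_eleven`**,
  `not_exists_type_fortyFour_sqrt_neg_one`, **`exists_principal_xor_type_fortyFour`**.

(At `44` the prime over `2`, `π′ = ζ³⁸(1 − ζ¹¹)(1 − ζ)`, `(π′)² = (2)`, flips as well — `|A_{π′}|/2 = 5`; not spelled out.)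

HONEST FRAMING: torus-level statements about Shimura's divisors `X_ζ′` of type `(K; Φ; 𝔣₀)` on the principal CM torus
`ℂ^Φ/Φ(ℤ[ζ_M])` [Sh98 §14.3 Prop. 4–5] and elementary ideal arithmetic in `ℤ[ζ_M]`; all residue sets are displayed and checked
by `decide`; WHICH component of the Weil-type locus (split or not) carries the polarised point is NOT decided here — its
hermitian discriminant class is `N_{K⁺/ℚ}(𝔣₀)` times the type-independent determinant class of the torus' trace form modulo
`Nm(K^×)`, split for some types and non-split for others (b01.17, exact periods: `A₃₆`'s degree-3 type lies on the split
`ℚ(√−3)` row, its degree-8 type on `R1 = (3, ℚ(√−3), 2)`); nothing here is a statement about Hodge classes,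
`W_K`, general members or HC; `HC_CM` is used nowhere.  No `def`, no named fact, no `sorry`.

References: [cite: Shimura1998, §14.3 Prop. 4–5, pp. 103–104]; [cite: Washington1997, §8.1, Lemma 1.4, Prop. 2.8]; census
b01.17 / b01.34–b01.38 (seat-derived).
-/

noncomputable section

open Polynomial NumberField Complex Finset
open scoped Real nonZeroDivisors

namespace Summit.HodgeConjecture.Ring2WeilCoverage.RamifiedTypesLevels33and44

open Literature.AlgebraicGeometry.Motives (CMType)
open Literature.AlgebraicGeometry.HodgeTheory (IsCMTypeSet)
open Literature.AlgebraicGeometry.ComplexMultiplication.CyclotomicCMType (isCMTypeSet_residueFilter)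
open Literature.NumberTheory.ComplexMultiplication
open Summit.HodgeConjecture.Ring2WeilCoverage.RamifiedTypes
open Summit.HodgeConjecture.Ring2WeilCoverage.RamifiedPrimePowers
open Summit.HodgeConjecture.Ring2WeilCoverage.CyclotomicUnitProducts (isUnit_one_sub_toInteger_pow)
open Summit.HodgeConjecture.Ring2WeilCoverage.CMTypeSetPairCount (card_inter_add_card_inter_eq)
open Summit.HodgeConjecture.Ring2WeilCoverage.CMTypeSetOddPositions (two_mul_card_eq_card_units)
open Summit.HodgeConjecture.Ring2WeilCoverage.CyclotomicSignaturesG10 (exists_units_sign_eq_thirtyThree exists_units_sign_eq_fortyFour)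
open Summit.HodgeConjecture.Ring2WeilCoverage.CyclotomicUnconditionalSqrtNegEleven (norm_realUnits_pos_thirtyThree norm_realUnits_pos_fortyFour)

variable {K : Type} [Field K] [NumberField K] {ζ : K}

/-- `𝐞(t) = exp(2πi t/n) ∈ ℂ` (`ZMod.toCircle`). -/
local notation3 (prettyPrint := false) "𝐞 " t:max => ((ZMod.toCircle t : Circle) : ℂ)

section Level33

/-- the residue set `S_Φ` read at level `33`. -/
local notation3 (prettyPrint := false) "SΦ[" Φ "," z "]" =>
  (Finset.univ.filter fun t : ZMod 33 => ∃ σ ∈ (Φ : CMType K).1, σ (z : K) = 𝐞 t)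

/-- part 48's twisted sign set `X_π` at level `33` (`n := 33`). -/
local notation3 (prettyPrint := false) "Xtw33 " x:max =>
  (Finset.univ.filter fun t : ZMod 33 => t.val.Coprime 33 ∧
    ¬ ((33 < (x : ℕ × ℕ × ℕ).1 * ZMod.val t % (2 * 33) ↔ 33 < (x : ℕ × ℕ × ℕ).2.1 * ZMod.val t % (2 * 33)) ↔
      Even (Finset.card (Finset.filter (fun s : ZMod 33 => s.val.Coprime 33 ∧ s.val < t.val) Finset.univ))))

/-- the census's `N_odd` at level `33` (part 5). -/
local notation3 (prettyPrint := false) "Nodd33" =>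
  (Finset.univ.filter fun t : ZMod 33 => t.val.Coprime 33 ∧
    Even (Finset.card (Finset.filter (fun s : ZMod 33 => s.val.Coprime 33 ∧ s.val < t.val) Finset.univ)))

/-- **`N_odd(33) = [1, 4, 7, 10, 14, 17, 20, 25, 28, 31]`** (`decide`). [folklore] -/
theorem nodd_thirtyThree_eq : Nodd33 = ({1, 4, 7, 10, 14, 17, 20, 25, 28, 31} : Finset (ZMod 33)) := by
  decide

/-! #### Level `33`, the type `𝔣₀` with `𝔬𝔣₀ = (π)`, `π = ζ^31(1 − ζ^3)(1 − ζ^1)` (`ζ^3` a primitive `11`-th root of unity: `(π) = (1 − ζ^3)`, `(π)^10 = (11)`) -/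

/-- the semi-admissibility of `x = (3, 1, 31)` at level `33` (`33 ∤ 3, 1`; `2·31 + 3 + 1 ≡ 0 (mod 66)`). [folklore] -/
theorem adm_thirtyThree : ¬ 33 ∣ ((3, 1, 31) : ℕ × ℕ × ℕ).1 ∧ ¬ 33 ∣ ((3, 1, 31) : ℕ × ℕ × ℕ).2.1 ∧
    (2 * ((3, 1, 31) : ℕ × ℕ × ℕ).2.2 + ((3, 1, 31) : ℕ × ℕ × ℕ).1 + ((3, 1, 31) : ℕ × ℕ × ℕ).2.1) % (2 * 33) = 0 := by
  decide

/-- **The twisted sign set at level `33` for `π = ζ^31(1 − ζ^3)(1 − ζ^1)`: `X_π = N_odd ∆ A_π = [2, 5, 8, 14, 17, 20, 23, 26, 29, 32]`** (`A_π = [1, 2, 4, 5, 7, 8, 10, 23, 25, 26, 28, 29, 31, 32]`, `|A_π|/2 = 7`;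
`decide`).
research route conditional on HC_CM; not a corollary; Q11.4-sentence-2 already refuted in dim ≥ 3. [folklore] -/
theorem twistSet_thirtyThree : Xtw33 ((3, 1, 31) : ℕ × ℕ × ℕ) = ({2, 5, 8, 14, 17, 20, 23, 26, 29, 32} : Finset (ZMod 33)) := by
  decide

/-- **A type `𝔣₀ ⊆ 𝓞 K⁺` with `𝔬𝔣₀ = (π)`, `π = ζ^31(1 − ζ^3)(1 − ζ^1)`, EXISTS** (part 48 `exists_ideal_map_eq_span_gen`).
research route conditional on HC_CM; not a corollary; Q11.4-sentence-2 already refuted in dim ≥ 3. [cite: Shimura1998, §14.3, p. 103] -/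
theorem exists_type_ideal_thirtyThree [IsCMField K] (hζ : IsPrimitiveRoot ζ 33) :
    ∃ 𝔣₀ : Ideal (𝓞 (maximalRealSubfield K)),
      𝔣₀.map (algebraMap (𝓞 (maximalRealSubfield K)) (𝓞 K)) = Ideal.span {hζ.toInteger ^ 31 * (1 - hζ.toInteger ^ 3) * (1 - hζ.toInteger ^ 1)} :=
  exists_ideal_map_eq_span_gen (x := ((3, 1, 31) : ℕ × ℕ × ℕ)) hζ adm_thirtyThree

omit [NumberField K] in
/-- **`(𝔬𝔣₀)^10 = (11)`** for the type `𝔣₀` with `𝔬𝔣₀ = (π)`, `π = ζ^31(1 − ζ^3)(1 − ζ^1)`: `(π) = (1 − ζ^3)` (the factors `ζ^31`,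
`1 − ζ^1` are units, part 13) and `(1 − ζ^3)^10 = (11)` (part 48c, `ζ^3` a primitive `11`-th root of unity) — so
`N(𝔬𝔣₀) = 11^2`, `N_{K⁺/ℚ}(𝔣₀) = 11^1`: a polarisation of type `𝔣₀` on `ℂ^Φ/Φ(ℤ[ζ_33])` has degree `11`.
research route conditional on HC_CM; not a corollary; Q11.4-sentence-2 already refuted in dim ≥ 3. [cite: Washington1997, Lemma 1.4, Prop. 2.8] -/
theorem map_type_pow_thirtyThree (hζ : IsPrimitiveRoot ζ 33) {𝔣₀ : Ideal (𝓞 (maximalRealSubfield K))}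
    (h𝔣₀ : 𝔣₀.map (algebraMap (𝓞 (maximalRealSubfield K)) (𝓞 K)) = Ideal.span {hζ.toInteger ^ 31 * (1 - hζ.toInteger ^ 3) * (1 - hζ.toInteger ^ 1)}) :
    𝔣₀.map (algebraMap (𝓞 (maximalRealSubfield K)) (𝓞 K)) ^ 10 = Ideal.span {(11 : 𝓞 K)} := by
  have hη : IsPrimitiveRoot (ζ ^ 3) 11 := hζ.pow (by norm_num) (by norm_num)
  have hηint : hη.toInteger = hζ.toInteger ^ 3 := RingOfIntegers.ext (by simp [IsPrimitiveRoot.toInteger])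
  have hu1 : IsUnit (hζ.toInteger ^ 31 : 𝓞 K) := (hζ.toInteger_isPrimitiveRoot.isUnit (by norm_num)).pow 31
  have hu2 : IsUnit (1 - hζ.toInteger ^ 1 : 𝓞 K) := isUnit_one_sub_toInteger_pow hζ (by decide) (by decide +kernel)
  rw [h𝔣₀, Ideal.span_singleton_mul_right_unit hu2, Ideal.span_singleton_mul_left_unit hu1, ← hηint]
  exact span_one_sub_pow_eq_eleven hη

open scoped Classical in
/-- **CENSUS ROW `(ℚ(ζ_33), ℚ(√−11))` (a NO row for principal polarisations) — the RAMIFIED TYPE EXISTS: for every CM type `Φ`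
of `ℚ(ζ_33)` balanced for `N_K = [2, 7, 8, 10, 13, 17, 19, 28, 29, 32]` (the Weil signature `(5,5)` on `K = ℚ(√−11)`) and every type `𝔣₀` with
`𝔬𝔣₀ = (π)`, `π = ζ^31(1 − ζ^3)(1 − ζ^1)`, the principal CM torus `ℂ^Φ/Φ(ℤ[ζ_33])` CARRIES a `Φ`-positive divisor `X_ζ′` of type
`(K; Φ; 𝔣₀)`** — `ζ′^ρ = −ζ′`, `Im φ(ζ′) > 0` on `Φ`, `IsOfType 1 ζ′ 𝔣₀` [Sh98 §14.3 Prop. 4: a polarisation whose `φ_X` is the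
`𝔬𝔣₀`-multiplication, of degree `11`].  Proof: part 48 `exists_type_of_even` + THEOREM L (ii) at `33` + the residue count
`|S_Φ ∩ X_π| ≡ |X_π ∖ N_K| + g/2 = 5 + 5 ≡ 0`.
research route conditional on HC_CM; not a corollary; Q11.4-sentence-2 already refuted in dim ≥ 3. [cite: Shimura1998, §14.3 Prop. 4–5, pp. 103–104] -/
theorem exists_type_thirtyThree_sqrt_neg_eleven [IsCMField K] [IsCyclotomicExtension {33} ℚ K] (hζ : IsPrimitiveRoot ζ 33)
    (Φ : CMType K) (hbal : 2 * (SΦ[Φ, ζ] ∩ ({2, 7, 8, 10, 13, 17, 19, 28, 29, 32} : Finset (ZMod 33))).card = (SΦ[Φ, ζ]).card)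
    {𝔣₀ : Ideal (𝓞 (maximalRealSubfield K))}
    (h𝔣₀ : 𝔣₀.map (algebraMap (𝓞 (maximalRealSubfield K)) (𝓞 K)) = Ideal.span {hζ.toInteger ^ 31 * (1 - hζ.toInteger ^ 3) * (1 - hζ.toInteger ^ 1)}) :
    ∃ ζ' : K, IsCMField.complexConj K ζ' = -ζ' ∧ (∀ φ : Φ.1, 0 < (φ.1 ζ').im) ∧
        CMTypeLattice.IsOfType (1 : (FractionalIdeal (𝓞 K)⁰ K)ˣ) ζ' 𝔣₀ := by
  have hg : Nat.totient 33 = 2 * (9 + 1) := by decide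
  refine exists_type_of_even hζ hg adm_thirtyThree Φ h𝔣₀ (exists_units_sign_eq_thirtyThree hζ Φ) ?_
  rw [twistSet_thirtyThree]
  have hS := isCMTypeSet_residueFilter hζ Φ
  have hX : IsCMTypeSet 33 ({2, 5, 8, 14, 17, 20, 23, 26, 29, 32} : Finset (ZMod 33)) := by decide
  have hNK : IsCMTypeSet 33 ({2, 7, 8, 10, 13, 17, 19, 28, 29, 32} : Finset (ZMod 33)) := by decide
  have h1 := card_inter_mod_two_eq hS hX hNK
  have h2 := two_mul_card_eq_card_units hS
  have hU : (Finset.univ.filter fun t : ZMod 33 => t.val.Coprime 33).card = 20 := by decide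
  have h3 : (({2, 5, 8, 14, 17, 20, 23, 26, 29, 32} : Finset (ZMod 33)) \ ({2, 7, 8, 10, 13, 17, 19, 28, 29, 32} : Finset (ZMod 33))).card = 5 := by decide
  rw [Nat.even_iff]
  omega

open scoped Classical in
/-- **CENSUS ROW `(ℚ(ζ_33), ℚ(√−11))`, headline form: there is a type `𝔣₀ ⊆ 𝓞 K⁺` with `(𝔬𝔣₀)^10 = (11)` such that
`ℂ^Φ/Φ(ℤ[ζ_33])` carries a `Φ`-positive divisor of type `(K; Φ; 𝔣₀)`** for every `K`-balanced CM type `Φ`, `K = ℚ(√−11)`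
(polarisation degree `11`; the census's NO row gets an explicit NON-principal polarisation).
research route conditional on HC_CM; not a corollary; Q11.4-sentence-2 already refuted in dim ≥ 3. [cite: Shimura1998, §14.3 Prop. 4–5, pp. 103–104] -/
theorem exists_ramifiedType_thirtyThree_sqrt_neg_eleven [IsCMField K] [IsCyclotomicExtension {33} ℚ K]
    (hζ : IsPrimitiveRoot ζ 33) (Φ : CMType K) (hbal : 2 * (SΦ[Φ, ζ] ∩ ({2, 7, 8, 10, 13, 17, 19, 28, 29, 32} : Finset (ZMod 33))).card = (SΦ[Φ, ζ]).card) :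
    ∃ 𝔣₀ : Ideal (𝓞 (maximalRealSubfield K)),
      𝔣₀.map (algebraMap (𝓞 (maximalRealSubfield K)) (𝓞 K)) ^ 10 = Ideal.span {(11 : 𝓞 K)} ∧
      ∃ ζ' : K, IsCMField.complexConj K ζ' = -ζ' ∧ (∀ φ : Φ.1, 0 < (φ.1 ζ').im) ∧
        CMTypeLattice.IsOfType (1 : (FractionalIdeal (𝓞 K)⁰ K)ˣ) ζ' 𝔣₀ := by
  obtain ⟨𝔣₀, h𝔣₀⟩ := exists_type_ideal_thirtyThree hζ
  exact ⟨𝔣₀, map_type_pow_thirtyThree hζ h𝔣₀, exists_type_thirtyThree_sqrt_neg_eleven hζ Φ hbal h𝔣₀⟩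

open scoped Classical in
/-- **Row `(ℚ(ζ_33), ℚ(√−3))` (a YES row for principal polarisations) does NOT carry the ramified type**: for `Φ` balanced
for `N_K = [2, 5, 8, 14, 17, 20, 23, 26, 29, 32]` (`K = ℚ(√−3)`) there is NO `Φ`-positive divisor of type `𝔣₀`, `𝔬𝔣₀ = (π)`, `π = ζ^31(1 − ζ^3)(1 − ζ^1)` —
THEOREM L (i) at `33` + the odd count `|S_Φ ∩ X_π| ≡ 0 + 5` (part 48 `not_exists_type_of_norm_pos_of_odd`).
research route conditional on HC_CM; not a corollary; Q11.4-sentence-2 already refuted in dim ≥ 3. [cite: Shimura1998, §14.3 Prop. 5, p. 104] -/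
theorem not_exists_type_thirtyThree_sqrt_neg_three [IsCMField K] [IsCyclotomicExtension {33} ℚ K] (hζ : IsPrimitiveRoot ζ 33)
    (Φ : CMType K) (hbal : 2 * (SΦ[Φ, ζ] ∩ ({2, 5, 8, 14, 17, 20, 23, 26, 29, 32} : Finset (ZMod 33))).card = (SΦ[Φ, ζ]).card)
    {𝔣₀ : Ideal (𝓞 (maximalRealSubfield K))}
    (h𝔣₀ : 𝔣₀.map (algebraMap (𝓞 (maximalRealSubfield K)) (𝓞 K)) = Ideal.span {hζ.toInteger ^ 31 * (1 - hζ.toInteger ^ 3) * (1 - hζ.toInteger ^ 1)}) :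
    ¬ ∃ ζ' : K, IsCMField.complexConj K ζ' = -ζ' ∧ (∀ φ : Φ.1, 0 < (φ.1 ζ').im) ∧
        CMTypeLattice.IsOfType (1 : (FractionalIdeal (𝓞 K)⁰ K)ˣ) ζ' 𝔣₀ := by
  have hg : Nat.totient 33 = 2 * (9 + 1) := by decide
  refine not_exists_type_of_norm_pos_of_odd hζ hg adm_thirtyThree Φ h𝔣₀ (norm_realUnits_pos_thirtyThree hζ) ?_
  rw [twistSet_thirtyThree]
  have hS := isCMTypeSet_residueFilter hζ Φ
  have hX : IsCMTypeSet 33 ({2, 5, 8, 14, 17, 20, 23, 26, 29, 32} : Finset (ZMod 33)) := by decide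
  have hNK : IsCMTypeSet 33 ({2, 5, 8, 14, 17, 20, 23, 26, 29, 32} : Finset (ZMod 33)) := by decide
  have h1 := card_inter_mod_two_eq hS hX hNK
  have h2 := two_mul_card_eq_card_units hS
  have hU : (Finset.univ.filter fun t : ZMod 33 => t.val.Coprime 33).card = 20 := by decide
  have h3 : (({2, 5, 8, 14, 17, 20, 23, 26, 29, 32} : Finset (ZMod 33)) \ ({2, 5, 8, 14, 17, 20, 23, 26, 29, 32} : Finset (ZMod 33))).card = 0 := by decide
  rw [Nat.odd_iff]
  omega

open scoped Classical in
/-- **DICHOTOMY AT LEVEL `33`: every one of the `2^10` CM types `Φ` of `ℚ(ζ_33)` makes `ℂ^Φ/Φ(ℤ[ζ_33])` carry EITHER an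
`ι`-compatible principal polarisation OR a `Φ`-positive divisor of the ramified type `𝔣₀` (`𝔬𝔣₀ = (π)`, `π = ζ^31(1 − ζ^3)(1 − ζ^1)`),
NEVER BOTH** — `|N_odd ∖ X_π| = |A_π|/2 = 7` is odd (equivalently `N_{K⁺/ℚ}(π) < 0`), THEOREM L (i)/(ii) at `33`, part 48
`exists_principal_xor_exists_type`.
research route conditional on HC_CM; not a corollary; Q11.4-sentence-2 already refuted in dim ≥ 3. [cite: Shimura1998, §14.3 Prop. 5, p. 104] -/
theorem exists_principal_xor_type_thirtyThree [IsCMField K] [IsCyclotomicExtension {33} ℚ K] (hζ : IsPrimitiveRoot ζ 33)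
    (Φ : CMType K) {𝔣₀ : Ideal (𝓞 (maximalRealSubfield K))}
    (h𝔣₀ : 𝔣₀.map (algebraMap (𝓞 (maximalRealSubfield K)) (𝓞 K)) = Ideal.span {hζ.toInteger ^ 31 * (1 - hζ.toInteger ^ 3) * (1 - hζ.toInteger ^ 1)}) :
    Xor (∃ ζ' : K, IsCMField.complexConj K ζ' = -ζ' ∧ (∀ φ : Φ.1, 0 < (φ.1 ζ').im) ∧
          CMTypeLattice.IsOfType (1 : (FractionalIdeal (𝓞 K)⁰ K)ˣ) ζ' ⊤)
      (∃ ζ' : K, IsCMField.complexConj K ζ' = -ζ' ∧ (∀ φ : Φ.1, 0 < (φ.1 ζ').im) ∧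
          CMTypeLattice.IsOfType (1 : (FractionalIdeal (𝓞 K)⁰ K)ˣ) ζ' 𝔣₀) := by
  have hg : Nat.totient 33 = 2 * (9 + 1) := by decide
  refine exists_principal_xor_exists_type hζ hg adm_thirtyThree Φ h𝔣₀ (norm_realUnits_pos_thirtyThree hζ)
    (exists_units_sign_eq_thirtyThree hζ Φ) ?_
  rw [twistSet_thirtyThree, nodd_thirtyThree_eq]
  have hS := isCMTypeSet_residueFilter hζ Φ
  have hN : IsCMTypeSet 33 ({1, 4, 7, 10, 14, 17, 20, 25, 28, 31} : Finset (ZMod 33)) := by decide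
  have hX : IsCMTypeSet 33 ({2, 5, 8, 14, 17, 20, 23, 26, 29, 32} : Finset (ZMod 33)) := by decide
  have h := card_inter_add_card_inter_eq hS hN hX
  have hd : (({1, 4, 7, 10, 14, 17, 20, 25, 28, 31} : Finset (ZMod 33)) \ ({2, 5, 8, 14, 17, 20, 23, 26, 29, 32} : Finset (ZMod 33))).card = 7 := by decide
  omega

end Level33

section Level44

/-- the residue set `S_Φ` read at level `44`. -/
local notation3 (prettyPrint := false) "SΦ[" Φ "," z "]" =>
  (Finset.univ.filter fun t : ZMod 44 => ∃ σ ∈ (Φ : CMType K).1, σ (z : K) = 𝐞 t)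

/-- part 48's twisted sign set `X_π` at level `44` (`n := 44`). -/
local notation3 (prettyPrint := false) "Xtw44 " x:max =>
  (Finset.univ.filter fun t : ZMod 44 => t.val.Coprime 44 ∧
    ¬ ((44 < (x : ℕ × ℕ × ℕ).1 * ZMod.val t % (2 * 44) ↔ 44 < (x : ℕ × ℕ × ℕ).2.1 * ZMod.val t % (2 * 44)) ↔
      Even (Finset.card (Finset.filter (fun s : ZMod 44 => s.val.Coprime 44 ∧ s.val < t.val) Finset.univ))))

/-- the census's `N_odd` at level `44` (part 5). -/
local notation3 (prettyPrint := false) "Nodd44" =>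
  (Finset.univ.filter fun t : ZMod 44 => t.val.Coprime 44 ∧
    Even (Finset.card (Finset.filter (fun s : ZMod 44 => s.val.Coprime 44 ∧ s.val < t.val) Finset.univ)))

/-- **`N_odd(44) = [1, 5, 9, 15, 19, 23, 27, 31, 37, 41]`** (`decide`). [folklore] -/
theorem nodd_fortyFour_eq : Nodd44 = ({1, 5, 9, 15, 19, 23, 27, 31, 37, 41} : Finset (ZMod 44)) := by
  decide

/-! #### Level `44`, the type `𝔣₀` with `𝔬𝔣₀ = (π)`, `π = ζ^41(1 − ζ^4)(1 − ζ^2)` (`ζ^4` a primitive `11`-th root of unity: `(π) = (1 − ζ^4)`, `(π)^10 = (11)`) -/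

/-- the semi-admissibility of `x = (4, 2, 41)` at level `44` (`44 ∤ 4, 2`; `2·41 + 4 + 2 ≡ 0 (mod 88)`). [folklore] -/
theorem adm_fortyFour : ¬ 44 ∣ ((4, 2, 41) : ℕ × ℕ × ℕ).1 ∧ ¬ 44 ∣ ((4, 2, 41) : ℕ × ℕ × ℕ).2.1 ∧
    (2 * ((4, 2, 41) : ℕ × ℕ × ℕ).2.2 + ((4, 2, 41) : ℕ × ℕ × ℕ).1 + ((4, 2, 41) : ℕ × ℕ × ℕ).2.1) % (2 * 44) = 0 := by
  decide

/-- **The twisted sign set at level `44` for `π = ζ^41(1 − ζ^4)(1 − ζ^2)`: `X_π = N_odd ∆ A_π = [3, 7, 15, 19, 23, 27, 31, 35, 39, 43]`** (`A_π = [1, 3, 5, 7, 9, 35, 37, 39, 41, 43]`, `|A_π|/2 = 5`;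
`decide`).
research route conditional on HC_CM; not a corollary; Q11.4-sentence-2 already refuted in dim ≥ 3. [folklore] -/
theorem twistSet_fortyFour : Xtw44 ((4, 2, 41) : ℕ × ℕ × ℕ) = ({3, 7, 15, 19, 23, 27, 31, 35, 39, 43} : Finset (ZMod 44)) := by
  decide

/-- **A type `𝔣₀ ⊆ 𝓞 K⁺` with `𝔬𝔣₀ = (π)`, `π = ζ^41(1 − ζ^4)(1 − ζ^2)`, EXISTS** (part 48 `exists_ideal_map_eq_span_gen`).
research route conditional on HC_CM; not a corollary; Q11.4-sentence-2 already refuted in dim ≥ 3. [cite: Shimura1998, §14.3, p. 103] -/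
theorem exists_type_ideal_fortyFour [IsCMField K] (hζ : IsPrimitiveRoot ζ 44) :
    ∃ 𝔣₀ : Ideal (𝓞 (maximalRealSubfield K)),
      𝔣₀.map (algebraMap (𝓞 (maximalRealSubfield K)) (𝓞 K)) = Ideal.span {hζ.toInteger ^ 41 * (1 - hζ.toInteger ^ 4) * (1 - hζ.toInteger ^ 2)} :=
  exists_ideal_map_eq_span_gen (x := ((4, 2, 41) : ℕ × ℕ × ℕ)) hζ adm_fortyFour

omit [NumberField K] in
/-- **`(𝔬𝔣₀)^10 = (11)`** for the type `𝔣₀` with `𝔬𝔣₀ = (π)`, `π = ζ^41(1 − ζ^4)(1 − ζ^2)`: `(π) = (1 − ζ^4)` (the factors `ζ^41`,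
`1 − ζ^2` are units, part 13) and `(1 − ζ^4)^10 = (11)` (part 48c, `ζ^4` a primitive `11`-th root of unity) — so
`N(𝔬𝔣₀) = 11^2`, `N_{K⁺/ℚ}(𝔣₀) = 11^1`: a polarisation of type `𝔣₀` on `ℂ^Φ/Φ(ℤ[ζ_44])` has degree `11`.
research route conditional on HC_CM; not a corollary; Q11.4-sentence-2 already refuted in dim ≥ 3. [cite: Washington1997, Lemma 1.4, Prop. 2.8] -/
theorem map_type_pow_fortyFour (hζ : IsPrimitiveRoot ζ 44) {𝔣₀ : Ideal (𝓞 (maximalRealSubfield K))}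
    (h𝔣₀ : 𝔣₀.map (algebraMap (𝓞 (maximalRealSubfield K)) (𝓞 K)) = Ideal.span {hζ.toInteger ^ 41 * (1 - hζ.toInteger ^ 4) * (1 - hζ.toInteger ^ 2)}) :
    𝔣₀.map (algebraMap (𝓞 (maximalRealSubfield K)) (𝓞 K)) ^ 10 = Ideal.span {(11 : 𝓞 K)} := by
  have hη : IsPrimitiveRoot (ζ ^ 4) 11 := hζ.pow (by norm_num) (by norm_num)
  have hηint : hη.toInteger = hζ.toInteger ^ 4 := RingOfIntegers.ext (by simp [IsPrimitiveRoot.toInteger])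
  have hu1 : IsUnit (hζ.toInteger ^ 41 : 𝓞 K) := (hζ.toInteger_isPrimitiveRoot.isUnit (by norm_num)).pow 41
  have hu2 : IsUnit (1 - hζ.toInteger ^ 2 : 𝓞 K) := isUnit_one_sub_toInteger_pow hζ (by decide) (by decide +kernel)
  rw [h𝔣₀, Ideal.span_singleton_mul_right_unit hu2, Ideal.span_singleton_mul_left_unit hu1, ← hηint]
  exact span_one_sub_pow_eq_eleven hη

open scoped Classical in
/-- **CENSUS ROW `(ℚ(ζ_44), ℚ(√−11))` (a NO row for principal polarisations) — the RAMIFIED TYPE EXISTS: for every CM type `Φ`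
of `ℚ(ζ_44)` balanced for `N_K = [7, 13, 17, 19, 21, 29, 35, 39, 41, 43]` (the Weil signature `(5,5)` on `K = ℚ(√−11)`) and every type `𝔣₀` with
`𝔬𝔣₀ = (π)`, `π = ζ^41(1 − ζ^4)(1 − ζ^2)`, the principal CM torus `ℂ^Φ/Φ(ℤ[ζ_44])` CARRIES a `Φ`-positive divisor `X_ζ′` of type
`(K; Φ; 𝔣₀)`** — `ζ′^ρ = −ζ′`, `Im φ(ζ′) > 0` on `Φ`, `IsOfType 1 ζ′ 𝔣₀` [Sh98 §14.3 Prop. 4: a polarisation whose `φ_X` is the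
`𝔬𝔣₀`-multiplication, of degree `11`].  Proof: part 48 `exists_type_of_even` + THEOREM L (ii) at `44` + the residue count
`|S_Φ ∩ X_π| ≡ |X_π ∖ N_K| + g/2 = 5 + 5 ≡ 0`.
research route conditional on HC_CM; not a corollary; Q11.4-sentence-2 already refuted in dim ≥ 3. [cite: Shimura1998, §14.3 Prop. 4–5, pp. 103–104] -/
theorem exists_type_fortyFour_sqrt_neg_eleven [IsCMField K] [IsCyclotomicExtension {44} ℚ K] (hζ : IsPrimitiveRoot ζ 44)
    (Φ : CMType K) (hbal : 2 * (SΦ[Φ, ζ] ∩ ({7, 13, 17, 19, 21, 29, 35, 39, 41, 43} : Finset (ZMod 44))).card = (SΦ[Φ, ζ]).card)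
    {𝔣₀ : Ideal (𝓞 (maximalRealSubfield K))}
    (h𝔣₀ : 𝔣₀.map (algebraMap (𝓞 (maximalRealSubfield K)) (𝓞 K)) = Ideal.span {hζ.toInteger ^ 41 * (1 - hζ.toInteger ^ 4) * (1 - hζ.toInteger ^ 2)}) :
    ∃ ζ' : K, IsCMField.complexConj K ζ' = -ζ' ∧ (∀ φ : Φ.1, 0 < (φ.1 ζ').im) ∧
        CMTypeLattice.IsOfType (1 : (FractionalIdeal (𝓞 K)⁰ K)ˣ) ζ' 𝔣₀ := by
  have hg : Nat.totient 44 = 2 * (9 + 1) := by decide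
  refine exists_type_of_even hζ hg adm_fortyFour Φ h𝔣₀ (exists_units_sign_eq_fortyFour hζ Φ) ?_
  rw [twistSet_fortyFour]
  have hS := isCMTypeSet_residueFilter hζ Φ
  have hX : IsCMTypeSet 44 ({3, 7, 15, 19, 23, 27, 31, 35, 39, 43} : Finset (ZMod 44)) := by decide
  have hNK : IsCMTypeSet 44 ({7, 13, 17, 19, 21, 29, 35, 39, 41, 43} : Finset (ZMod 44)) := by decide
  have h1 := card_inter_mod_two_eq hS hX hNK
  have h2 := two_mul_card_eq_card_units hS
  have hU : (Finset.univ.filter fun t : ZMod 44 => t.val.Coprime 44).card = 20 := by decide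
  have h3 : (({3, 7, 15, 19, 23, 27, 31, 35, 39, 43} : Finset (ZMod 44)) \ ({7, 13, 17, 19, 21, 29, 35, 39, 41, 43} : Finset (ZMod 44))).card = 5 := by decide
  rw [Nat.even_iff]
  omega

open scoped Classical in
/-- **CENSUS ROW `(ℚ(ζ_44), ℚ(√−11))`, headline form: there is a type `𝔣₀ ⊆ 𝓞 K⁺` with `(𝔬𝔣₀)^10 = (11)` such that
`ℂ^Φ/Φ(ℤ[ζ_44])` carries a `Φ`-positive divisor of type `(K; Φ; 𝔣₀)`** for every `K`-balanced CM type `Φ`, `K = ℚ(√−11)`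
(polarisation degree `11`; the census's NO row gets an explicit NON-principal polarisation).
research route conditional on HC_CM; not a corollary; Q11.4-sentence-2 already refuted in dim ≥ 3. [cite: Shimura1998, §14.3 Prop. 4–5, pp. 103–104] -/
theorem exists_ramifiedType_fortyFour_sqrt_neg_eleven [IsCMField K] [IsCyclotomicExtension {44} ℚ K]
    (hζ : IsPrimitiveRoot ζ 44) (Φ : CMType K) (hbal : 2 * (SΦ[Φ, ζ] ∩ ({7, 13, 17, 19, 21, 29, 35, 39, 41, 43} : Finset (ZMod 44))).card = (SΦ[Φ, ζ]).card) :
    ∃ 𝔣₀ : Ideal (𝓞 (maximalRealSubfield K)),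
      𝔣₀.map (algebraMap (𝓞 (maximalRealSubfield K)) (𝓞 K)) ^ 10 = Ideal.span {(11 : 𝓞 K)} ∧
      ∃ ζ' : K, IsCMField.complexConj K ζ' = -ζ' ∧ (∀ φ : Φ.1, 0 < (φ.1 ζ').im) ∧
        CMTypeLattice.IsOfType (1 : (FractionalIdeal (𝓞 K)⁰ K)ˣ) ζ' 𝔣₀ := by
  obtain ⟨𝔣₀, h𝔣₀⟩ := exists_type_ideal_fortyFour hζ
  exact ⟨𝔣₀, map_type_pow_fortyFour hζ h𝔣₀, exists_type_fortyFour_sqrt_neg_eleven hζ Φ hbal h𝔣₀⟩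

open scoped Classical in
/-- **Row `(ℚ(ζ_44), ℚ(i))` (a YES row for principal polarisations) does NOT carry the ramified type**: for `Φ` balanced
for `N_K = [3, 7, 15, 19, 23, 27, 31, 35, 39, 43]` (`K = ℚ(i)`) there is NO `Φ`-positive divisor of type `𝔣₀`, `𝔬𝔣₀ = (π)`, `π = ζ^41(1 − ζ^4)(1 − ζ^2)` —
THEOREM L (i) at `44` + the odd count `|S_Φ ∩ X_π| ≡ 0 + 5` (part 48 `not_exists_type_of_norm_pos_of_odd`).
research route conditional on HC_CM; not a corollary; Q11.4-sentence-2 already refuted in dim ≥ 3. [cite: Shimura1998, §14.3 Prop. 5, p. 104] -/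
theorem not_exists_type_fortyFour_sqrt_neg_one [IsCMField K] [IsCyclotomicExtension {44} ℚ K] (hζ : IsPrimitiveRoot ζ 44)
    (Φ : CMType K) (hbal : 2 * (SΦ[Φ, ζ] ∩ ({3, 7, 15, 19, 23, 27, 31, 35, 39, 43} : Finset (ZMod 44))).card = (SΦ[Φ, ζ]).card)
    {𝔣₀ : Ideal (𝓞 (maximalRealSubfield K))}
    (h𝔣₀ : 𝔣₀.map (algebraMap (𝓞 (maximalRealSubfield K)) (𝓞 K)) = Ideal.span {hζ.toInteger ^ 41 * (1 - hζ.toInteger ^ 4) * (1 - hζ.toInteger ^ 2)}) :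
    ¬ ∃ ζ' : K, IsCMField.complexConj K ζ' = -ζ' ∧ (∀ φ : Φ.1, 0 < (φ.1 ζ').im) ∧
        CMTypeLattice.IsOfType (1 : (FractionalIdeal (𝓞 K)⁰ K)ˣ) ζ' 𝔣₀ := by
  have hg : Nat.totient 44 = 2 * (9 + 1) := by decide
  refine not_exists_type_of_norm_pos_of_odd hζ hg adm_fortyFour Φ h𝔣₀ (norm_realUnits_pos_fortyFour hζ) ?_
  rw [twistSet_fortyFour]
  have hS := isCMTypeSet_residueFilter hζ Φ
  have hX : IsCMTypeSet 44 ({3, 7, 15, 19, 23, 27, 31, 35, 39, 43} : Finset (ZMod 44)) := by decide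
  have hNK : IsCMTypeSet 44 ({3, 7, 15, 19, 23, 27, 31, 35, 39, 43} : Finset (ZMod 44)) := by decide
  have h1 := card_inter_mod_two_eq hS hX hNK
  have h2 := two_mul_card_eq_card_units hS
  have hU : (Finset.univ.filter fun t : ZMod 44 => t.val.Coprime 44).card = 20 := by decide
  have h3 : (({3, 7, 15, 19, 23, 27, 31, 35, 39, 43} : Finset (ZMod 44)) \ ({3, 7, 15, 19, 23, 27, 31, 35, 39, 43} : Finset (ZMod 44))).card = 0 := by decide
  rw [Nat.odd_iff]
  omega

open scoped Classical in
/-- **DICHOTOMY AT LEVEL `44`: every one of the `2^10` CM types `Φ` of `ℚ(ζ_44)` makes `ℂ^Φ/Φ(ℤ[ζ_44])` carry EITHER an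
`ι`-compatible principal polarisation OR a `Φ`-positive divisor of the ramified type `𝔣₀` (`𝔬𝔣₀ = (π)`, `π = ζ^41(1 − ζ^4)(1 − ζ^2)`),
NEVER BOTH** — `|N_odd ∖ X_π| = |A_π|/2 = 5` is odd (equivalently `N_{K⁺/ℚ}(π) < 0`), THEOREM L (i)/(ii) at `44`, part 48
`exists_principal_xor_exists_type`.
research route conditional on HC_CM; not a corollary; Q11.4-sentence-2 already refuted in dim ≥ 3. [cite: Shimura1998, §14.3 Prop. 5, p. 104] -/
theorem exists_principal_xor_type_fortyFour [IsCMField K] [IsCyclotomicExtension {44} ℚ K] (hζ : IsPrimitiveRoot ζ 44)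
    (Φ : CMType K) {𝔣₀ : Ideal (𝓞 (maximalRealSubfield K))}
    (h𝔣₀ : 𝔣₀.map (algebraMap (𝓞 (maximalRealSubfield K)) (𝓞 K)) = Ideal.span {hζ.toInteger ^ 41 * (1 - hζ.toInteger ^ 4) * (1 - hζ.toInteger ^ 2)}) :
    Xor (∃ ζ' : K, IsCMField.complexConj K ζ' = -ζ' ∧ (∀ φ : Φ.1, 0 < (φ.1 ζ').im) ∧
          CMTypeLattice.IsOfType (1 : (FractionalIdeal (𝓞 K)⁰ K)ˣ) ζ' ⊤)
      (∃ ζ' : K, IsCMField.complexConj K ζ' = -ζ' ∧ (∀ φ : Φ.1, 0 < (φ.1 ζ').im) ∧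
          CMTypeLattice.IsOfType (1 : (FractionalIdeal (𝓞 K)⁰ K)ˣ) ζ' 𝔣₀) := by
  have hg : Nat.totient 44 = 2 * (9 + 1) := by decide
  refine exists_principal_xor_exists_type hζ hg adm_fortyFour Φ h𝔣₀ (norm_realUnits_pos_fortyFour hζ)
    (exists_units_sign_eq_fortyFour hζ Φ) ?_
  rw [twistSet_fortyFour, nodd_fortyFour_eq]
  have hS := isCMTypeSet_residueFilter hζ Φ
  have hN : IsCMTypeSet 44 ({1, 5, 9, 15, 19, 23, 27, 31, 37, 41} : Finset (ZMod 44)) := by decide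
  have hX : IsCMTypeSet 44 ({3, 7, 15, 19, 23, 27, 31, 35, 39, 43} : Finset (ZMod 44)) := by decide
  have h := card_inter_add_card_inter_eq hS hN hX
  have hd : (({1, 5, 9, 15, 19, 23, 27, 31, 37, 41} : Finset (ZMod 44)) \ ({3, 7, 15, 19, 23, 27, 31, 35, 39, 43} : Finset (ZMod 44))).card = 5 := by decide
  omega

end Level44

end Summit.HodgeConjecture.Ring2WeilCoverage.RamifiedTypesLevels33and44

end
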